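import Summits.QuantumFields.YangMills.Theses.MirrorModularBoosts
import Literature.MathematicalPhysics.QuantumFieldTheory.LatticeGaugeStrongCouplingProofs
import Literature.MathematicalPhysics.QuantumFieldTheory.YangMillsEuclideanProofs
import Literature.MathematicalPhysics.QuantumFieldTheory.TorusFreeTransfer
import Literature.MathematicalPhysics.AQFT.OSAxiomsSchwinger

/-!
# Refutation of `MirrorModularBoosts.DiagonalMirrorRP`

The crux quantifies over an ARBITRARY one-species Schwinger family `S₁` and constrains it only
through the convergence of the lattice curvature correlations for `n ≠ 0` points (real tensor
test functions on `⁰𝒮`); the zero-point functional `S₁ 0` is free. Its hypotheses are met by the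
degenerate data already in the tree: `G = SU(2)`, the fundamental representation, the zero
scheme `SpeciesScheme.zero` (`c ≡ 0`, so every lattice `n`-point function with `n ≠ 0` vanishes,
cf. `isYangMillsFor_vacuum`; `β ≡ 0`, so the torus Wilson measure is the Haar product and
bond-disjoint observables are independent, which gives `HasLatticeMassGap … 1`), and the family
`S₁ 0 = -δ`, `S₁ n = 0` (`n ≠ 0`). Reflection positivity of the pulled-back family then fails on
the single zero-point term `F₀ = 1`: `𝔖₀(θF₀* ⊗ F₀) = -1 < 0`.
-/

namespace Summit.QuantumFields.YangMills.Theses.MirrorModularBoosts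

open scoped BigOperators Topology Manifold Classical MeasureTheory ProbabilityTheory Matrix InnerProductSpace ComplexConjugate ContinuousMap
open Filter Set Function TopologicalSpace MeasureTheory

/-- **Record of the replaced/dropped route item `DiagonalMirrorRP`** = stmt-QuantumFields-9665 (ledger signature verbatim, in
the route file's namespace and `open` context; NOT a route item): after `MirrorModularBoostsDiagonalMirrorRP_refuted` (below) closed the
item `refuted` at 9c01c382260b, the route repair (`restate` under a new name, or `drop`) removed
this constant from the gate-written Theses file, while the Theorems file below — append-only,
statement text fixed — still names it ("Unknown identifier" in the full builds of 2026-08-16).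
Re-declared here under its original fully-qualified name and definiens solely so that this record
keeps elaborating. FALSE (refuted below). -/
def DiagonalMirrorRP : Prop :=
  open Literature.MathematicalPhysics.QuantumLattice Literature.MathematicalPhysics.AQFT Literature.MathematicalPhysics.QuantumFieldTheory in let E := EuclideanSpace ℝ (Fin 4); ∀ (G : Type) [Group G] [TopologicalSpace G] [IsTopologicalGroup G] [CompactSpace G], IsCompactSimpleLieGroup G → letI : MeasurableSpace G := borel G; haveI : BorelSpace G := ⟨rfl⟩; ∀ (r : LatticeRep G) (sch : SpeciesScheme (YMSpecies G)) (S₁ : SchwingerFamily E), (∀ (n : ℕ), n ≠ 0 → ∀ (f : Fin n → SchwartzMap (E) ℝ) (F : SchwartzMap (Fin n → E) ℂ), IsTensorOf F (fun i => ofRealTest (f i)) → IsOffDiagonal F → Filter.Tendsto (fun k : ℕ => ((latticeSchwinger r.ρ sch (fun s => s.F) k n (fun _ => r.curvature) f : ℝ) : ℂ)) Filter.atTop (nhds (S₁ n F))) → ∀ Δ : ℝ, 0 < Δ → HasLatticeMassGap r sch Δ → ∀ (R : E ≃ₗᵢ[ℝ] E) (a b : ℝ), a ^ 2 = 1 / 2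 → b ^ 2 = 1 / 2 → R (EuclideanSpace.single 0 1) = a • EuclideanSpace.single 0 1 + b • EuclideanSpace.single 1 1 → (SchwingerFamily.toLabelled (fun n => (S₁ n).comp (linActMulti R))).IsReflectionPositive

end Summit.QuantumFields.YangMills.Theses.MirrorModularBoosts

namespace Summit.QuantumFields.YangMills.Theorems

open MeasureTheory Filter Topology
open Literature.MathematicalPhysics.QuantumLattice Literature.MathematicalPhysics.AQFT
  Literature.MathematicalPhysics.QuantumFieldTheory

/-- Refutes `MirrorModularBoosts.DiagonalMirrorRP`: "for every compact simple `G`, lattice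
representation `r`, scheme `sch` and one-species family `S₁` that is the limit of the lattice
curvature correlations, a uniform lattice mass gap implies reflection positivity of `S₁` pulled
back by every diagonal frame". Witness: `G = SU(2)`, `r` = fundamental representation,
`sch = SpeciesScheme.zero` (all lattice correlations vanish for `n ≠ 0`; at `β = 0` the torus
Wilson measure is the Haar product, whence `HasLatticeMassGap r sch 1` by independence of
bond-disjoint observables), `S₁ 0 = -δ_pt`, `S₁ n = 0` for `n ≠ 0`, and the diagonal frame given by
the reflection taking `e₀` to `(e₀ + e₁)/√2`; the zero-point term of (E2) equals `-1`. [folklore] -/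
theorem MirrorModularBoostsDiagonalMirrorRP_refuted :
    ¬ Summit.QuantumFields.YangMills.Theses.MirrorModularBoosts.DiagonalMirrorRP := by
  intro h
  have hG : IsCompactSimpleLieGroup (Matrix.specialUnitaryGroup (Fin 2) ℂ) :=
    isCompactSimpleLieGroup_specialUnitaryGroup isSimpleCompactGroup_specialUnitaryGroup_holds le_rfl
  letI : MeasurableSpace (Matrix.specialUnitaryGroup (Fin 2) ℂ) := borel _
  haveI : BorelSpace (Matrix.specialUnitaryGroup (Fin 2) ℂ) := ⟨rfl⟩
  -- the faithful unitary lattice representation and the junk one-species family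
  let r : LatticeRep (Matrix.specialUnitaryGroup (Fin 2) ℂ) :=
    ⟨2, fundamentalRep (Fin 2), continuous_fundamentalRep _, fundamentalRep_injective _,
      fundamentalRep_mem_unitaryGroup⟩
  let S₁ : SchwingerFamily (EuclideanSpace ℝ (Fin 4)) := fun n =>
    if n = 0 then -LabelledSchwingerFamily.evalAt (0 : Fin n → EuclideanSpace ℝ (Fin 4)) else 0
  -- a diagonal frame: the reflection taking `e₀` to `(e₀ + e₁)/√2`
  obtain ⟨R, a, b, ha, hb, hR⟩ : ∃ (R : EuclideanSpace ℝ (Fin 4) ≃ₗᵢ[ℝ] EuclideanSpace ℝ (Fin 4))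
      (a b : ℝ), a ^ 2 = 1 / 2 ∧ b ^ 2 = 1 / 2 ∧
      R (EuclideanSpace.single 0 1) = a • EuclideanSpace.single 0 1 + b • EuclideanSpace.single 1 1 := by
    set a : ℝ := 1 / Real.sqrt 2 with ha_def
    have ha2 : a ^ 2 = 1 / 2 := by
      rw [ha_def, div_pow, one_pow, Real.sq_sqrt (by norm_num : (0 : ℝ) ≤ 2)]
    set v : EuclideanSpace ℝ (Fin 4) := EuclideanSpace.single 0 1 with hv
    set w : EuclideanSpace ℝ (Fin 4) := a • EuclideanSpace.single 0 1 + a • EuclideanSpace.single 1 1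
      with hw
    have hnorm : ‖v‖ = ‖w‖ := by
      have h1 : ‖v‖ = 1 := by
        rw [hv, EuclideanSpace.norm_eq]
        simp
      have h2 : ‖w‖ = 1 := by
        have hsum : ∑ i : Fin 4, ‖w i‖ ^ 2 = a ^ 2 + a ^ 2 := by
          rw [hw]
          simp [Fin.sum_univ_four, PiLp.single_apply]
        rw [EuclideanSpace.norm_eq, hsum, ← two_mul, ha2]
        norm_num
      rw [h1, h2]
    exact ⟨(Submodule.span ℝ {v - w})ᗮ.reflection, a, a, ha2, ha2, Submodule.reflection_sub hnorm⟩
  -- (1) the lattice correlations of the zero scheme vanish, hence converge to `S₁ n = 0`, `n ≠ 0`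
  have hconv : ∀ (n : ℕ), n ≠ 0 → ∀ (f : Fin n → SchwartzMap (EuclideanSpace ℝ (Fin 4)) ℝ)
      (F : SchwartzMap (Fin n → EuclideanSpace ℝ (Fin 4)) ℂ),
      IsTensorOf F (fun i => ofRealTest (f i)) → IsOffDiagonal F →
        Tendsto (fun k : ℕ => ((latticeSchwinger r.ρ (SpeciesScheme.zero _) (fun s => s.F) k n
          (fun _ => r.curvature) f : ℝ) : ℂ)) atTop (𝓝 (S₁ n F)) := by
    intro n hn f F _ _
    have hS : S₁ n F = 0 := by simp [S₁, hn]
    rw [hS]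
    refine tendsto_const_nhds.congr' (Eventually.of_forall fun k => ?_)
    obtain ⟨j, rfl⟩ := Nat.exists_eq_succ_of_ne_zero hn
    simp [latticeSchwinger, smearedLatticeField]
  -- (2) the uniform lattice mass gap of the zero scheme (`β ≡ 0`: Haar product, independence)
  have hgap : HasLatticeMassGap r (SpeciesScheme.zero (YMSpecies (Matrix.specialUnitaryGroup (Fin 2) ℂ))) 1 := by
    intro A B
    classical
    obtain ⟨MA, hMA⟩ := A.bounded
    obtain ⟨MB, hMB⟩ := B.bounded
    have hMA0 : 0 ≤ MA := (abs_nonneg _).trans (hMA fun _ => 1)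
    have hMB0 : 0 ≤ MB := (abs_nonneg _).trans (hMB fun _ => 1)
    -- the finitely many time separations with overlapping supports, and a radius for the supports
    let D : Finset ℤ := (A.supp ×ˢ B.supp).image fun p => (p.1.1 - p.2.1) 0
    let N₀ : ℕ := D.sum (fun z => z.natAbs) + 1
    let Rad : ℕ := (A.supp ∪ B.supp).sum fun e => ∑ i, (e.1 i).natAbs
    have hRad : ∀ e ∈ A.supp ∪ B.supp, ∀ i, |e.1 i| ≤ Rad := by
      intro e he i
      have h1 : (e.1 i).natAbs ≤ ∑ j, (e.1 j).natAbs :=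
        Finset.single_le_sum (f := fun j => (e.1 j).natAbs) (fun _ _ => Nat.zero_le _) (Finset.mem_univ i)
      have h2 : ∑ j, (e.1 j).natAbs ≤ Rad :=
        Finset.single_le_sum (f := fun e => ∑ j, (e.1 j).natAbs) (fun _ _ => Nat.zero_le _) he
      rw [Int.abs_eq_natAbs]
      exact_mod_cast h1.trans h2
    refine ⟨2 * MA * MB * Real.exp N₀ + 1, Filter.eventually_atTop.2 ⟨2 * Rad, fun k hk S hS n hn => ?_⟩⟩
    have hS' : (k + 1) ^ 2 ≤ S := hS
    have hkS : k + 1 ≤ (k + 1) ^ 2 := Nat.le_self_pow two_ne_zero _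
    have hRS : 2 * Rad ≤ S := by omega
    show |latticeConnectedCorr r.ρ 0 (2 * S + 1) A.F B.F n| ≤
      (2 * MA * MB * Real.exp N₀ + 1) * Real.exp (-(1 * (((k : ℝ) + 1)⁻¹ * n)))
    have hC0 : 0 ≤ 2 * MA * MB * Real.exp N₀ + 1 := by positivity
    by_cases hnN : n < N₀
    · -- overlapping supports: the crude bound `2 M_A M_B`
      have e1 := abs_wilsonExpectation_le_of_abs_le (L := 2 * S + 1) r.ρ r.continuous 0
        (F := fun U => A.F (torusLift (2 * S + 1) U) *
          B.F (configShift (-Pi.single 0 (n : ℤ)) (torusLift (2 * S + 1) U)))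
        (C := MA * MB) fun U => by
          rw [abs_mul]; exact mul_le_mul (hMA _) (hMB _) (abs_nonneg _) hMA0
      have e2 := abs_wilsonExpectation_le_of_abs_le (L := 2 * S + 1) r.ρ r.continuous 0
        (F := fun U => A.F (torusLift (2 * S + 1) U)) (C := MA) fun U => hMA _
      have e3 := abs_wilsonExpectation_le_of_abs_le (L := 2 * S + 1) r.ρ r.continuous 0
        (F := fun U => B.F (torusLift (2 * S + 1) U)) (C := MB) fun U => hMB _
      simp only [wilsonExpectation] at e1 e2 e3
      have hcorr : |latticeConnectedCorr r.ρ 0 (2 * S + 1) A.F B.F n| ≤ 2 * MA * MB := by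
        unfold latticeConnectedCorr
        calc _ ≤ _ := abs_sub _ _
          _ ≤ MA * MB + MA * MB :=
            add_le_add e1 (by rw [abs_mul]; exact mul_le_mul e2 e3 (abs_nonneg _) hMA0)
          _ = 2 * MA * MB := by ring
      have hexp : Real.exp (-(N₀ : ℝ)) ≤ Real.exp (-(1 * (((k : ℝ) + 1)⁻¹ * n))) := by
        apply Real.exp_le_exp.2
        have hk1 : ((k : ℝ) + 1)⁻¹ ≤ 1 := inv_le_one_of_one_le₀ (by linarith [(k.cast_nonneg : (0 : ℝ) ≤ k)])
        have hkn : ((k : ℝ) + 1)⁻¹ * n ≤ n := mul_le_of_le_one_left (Nat.cast_nonneg n) hk1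
        have hnN' : (n : ℝ) ≤ N₀ := by exact_mod_cast hnN.le
        linarith
      calc |latticeConnectedCorr r.ρ 0 (2 * S + 1) A.F B.F n| ≤ 2 * MA * MB := hcorr
        _ = (2 * MA * MB * Real.exp N₀) * Real.exp (-(N₀ : ℝ)) := by
            rw [mul_assoc (2 * MA * MB), ← Real.exp_add, add_neg_cancel, Real.exp_zero, mul_one]
        _ ≤ (2 * MA * MB * Real.exp N₀ + 1) * Real.exp (-(N₀ : ℝ)) := by
            gcongr; linarith
        _ ≤ (2 * MA * MB * Real.exp N₀ + 1) * Real.exp (-(1 * (((k : ℝ) + 1)⁻¹ * n))) :=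
            mul_le_mul_of_nonneg_left hexp hC0
    · -- disjoint supports: at `β = 0` the connected correlation vanishes
      have hnN' : N₀ ≤ n := not_lt.1 hnN
      suffices hzero : latticeConnectedCorr r.ρ 0 (2 * S + 1) A.F B.F n = 0 by
        rw [hzero, abs_zero]; positivity
      unfold latticeConnectedCorr
      -- the shifted support of `B` and the joint support
      set v : Literature.Probability.LatticeModels.Site 4 := -Pi.single 0 (n : ℤ) with hv
      let T := B.supp.image fun e => (e.1 - v, e.2)
      have hB' : IsCylinder (fun U => B.F (configShift v U)) T := IsCylinder.comp_configShift B.isCylinder v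
      have hAB : IsCylinder (fun U => A.F U * B.F (configShift v U)) (A.supp ∪ T) :=
        IsCylinder.mul A.isCylinder hB'
      -- all supports sit in the slab `-Rad ≤ xᵢ ≤ Rad + n`
      have hslab : ∀ e ∈ A.supp ∪ T, ∀ i, -(Rad : ℤ) ≤ e.1 i ∧ e.1 i ≤ Rad + n := by
        intro e he i
        rcases Finset.mem_union.1 he with heA | heT
        · have h := abs_le.1 (hRad e (Finset.mem_union_left _ heA) i)
          exact ⟨h.1, h.2.trans (by omega)⟩
        · obtain ⟨b', hb', rfl⟩ := Finset.mem_image.1 heT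
          have h := abs_le.1 (hRad b' (Finset.mem_union_right _ hb') i)
          have hsingle : (0 : ℤ) ≤ Pi.single (M := fun _ : Fin 4 => ℤ) 0 (n : ℤ) i ∧
              Pi.single (M := fun _ : Fin 4 => ℤ) 0 (n : ℤ) i ≤ n := by
            by_cases hi : i = 0
            · subst hi; simp
            · simp [hi]
          simp only [hv, Pi.sub_apply, Pi.neg_apply, sub_neg_eq_add]
          exact ⟨by omega, by omega⟩
      -- injectivity of the periodisation on the joint support
      have hinj : Set.InjOn (torusEdge (d := 4) (2 * S + 1)) ↑(A.supp ∪ T) := by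
        intro e he e' he' hee'
        simp only [torusEdge, Prod.mk.injEq] at hee'
        refine Prod.ext (funext fun i => ?_) hee'.2
        have hk : ((e.1 i : ℤ) : ZMod (2 * S + 1)) = ((e'.1 i : ℤ) : ZMod (2 * S + 1)) := by
          have := congrFun hee'.1 i
          simpa [Literature.Probability.LatticeModels.Torus.proj_apply] using this
        have hdvd := (ZMod.intCast_eq_intCast_iff_dvd_sub _ _ _).1 hk
        obtain ⟨lo, hi⟩ := hslab e he i
        obtain ⟨lo', hi'⟩ := hslab e' he' i
        have hlt : |e'.1 i - e.1 i| < ((2 * S + 1 : ℕ) : ℤ) := by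
          rw [abs_lt]; push_cast; constructor <;> omega
        have h0 := Int.eq_zero_of_abs_lt_dvd hdvd hlt
        omega
      -- disjointness of the supports for `n ≥ N₀`
      have hdisj : Disjoint A.supp T := by
        rw [Finset.disjoint_left]
        intro e heA heT
        obtain ⟨b', hb', hbe⟩ := Finset.mem_image.1 heT
        have hmem : (n : ℤ) ∈ D := by
          refine Finset.mem_image.2 ⟨(e, b'), Finset.mem_product.2 ⟨heA, hb'⟩, ?_⟩
          rw [← hbe]
          simp [hv]
        have hle : (n : ℤ).natAbs ≤ D.sum fun z => z.natAbs :=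
          Finset.single_le_sum (f := fun z : ℤ => z.natAbs) (fun _ _ => Nat.zero_le _) hmem
        simp only [Int.natAbs_natCast] at hle
        omega
      -- at `β = 0` the torus Wilson measure is the Haar product
      have hW0 : wilsonMeasure (d := 4) (L := 2 * S + 1) r.ρ 0 =
          Measure.pi fun _ => haarProbability (Matrix.specialUnitaryGroup (Fin 2) ℂ) := by
        have h1 : wilsonWeight (d := 4) (L := 2 * S + 1) r.ρ 0 =
            Measure.pi fun _ => haarProbability (Matrix.specialUnitaryGroup (Fin 2) ℂ) := by
          unfold wilsonWeight
          simp only [neg_zero, zero_mul, Real.exp_zero, ENNReal.ofReal_one]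
          exact withDensity_one
        unfold wilsonMeasure partitionFunction
        rw [h1, measure_univ, inv_one, one_smul]
      -- transfer to `ℤ⁴` and independence of bond-disjoint observables under the Haar product
      have tA := integral_torusLift_eq_integral_zdHaar (L := 2 * S + 1) (F := A.F)
        (hinj.mono (Finset.coe_subset.2 Finset.subset_union_left)) A.measurable A.isCylinder
      have tB := integral_torusLift_eq_integral_zdHaar (L := 2 * S + 1)
        (F := fun U => B.F (configShift v U))
        (hinj.mono (Finset.coe_subset.2 Finset.subset_union_right))
        (B.measurable.comp (configShift v).measurable) hB'
      have tAB := integral_torusLift_eq_integral_zdHaar (L := 2 * S + 1)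
        (F := fun U => A.F U * B.F (configShift v U)) hinj
        (A.measurable.mul (B.measurable.comp (configShift v).measurable)) hAB
      have hind := integral_mul_of_dependsOn (G := Matrix.specialUnitaryGroup (Fin 2) ℂ)
        (g := fun U => (A.F U : ℂ)) (h := fun U => (B.F (configShift v U) : ℂ)) hdisj
        (Complex.measurable_ofReal.comp A.measurable)
        (Complex.measurable_ofReal.comp (B.measurable.comp (configShift v).measurable))
        (fun U V hUV => by simp only [A.isCylinder hUV]) (fun U V hUV => by simp only [hB' hUV])
      have hreal : ∫ U, A.F U * B.F (configShift v U) ∂(zdHaar 4 (Matrix.specialUnitaryGroup (Fin 2) ℂ)) =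
          (∫ U, A.F U ∂(zdHaar 4 (Matrix.specialUnitaryGroup (Fin 2) ℂ))) *
            ∫ U, B.F (configShift v U) ∂(zdHaar 4 (Matrix.specialUnitaryGroup (Fin 2) ℂ)) := by
        apply Complex.ofReal_injective
        rw [Complex.ofReal_mul, ← integral_complex_ofReal, ← integral_complex_ofReal,
          ← integral_complex_ofReal]
        simp only [Complex.ofReal_mul]
        exact hind
      -- translation invariance on the torus: `⟨B ∘ θ_v⟩ = ⟨B⟩`
      have hZ : ∫ U, B.F (torusLift (2 * S + 1) U) ∂(wilsonMeasure (d := 4) (L := 2 * S + 1) r.ρ 0) =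
          ∫ U, B.F (configShift v (torusLift (2 * S + 1) U))
            ∂(wilsonMeasure (d := 4) (L := 2 * S + 1) r.ρ 0) := by
        have ht := wilsonExpectation_comp_torusConfigShift (ρ := r.ρ) (L := 2 * S + 1) 0
          (Literature.Probability.LatticeModels.Torus.proj (2 * S + 1) v) (toTorusObservable (2 * S + 1) B.F)
        rw [← toTorusObservable_comp_configShift] at ht
        simp only [wilsonExpectation, toTorusObservable_apply, Function.comp_apply] at ht
        exact ht.symm
      rw [hZ, hW0, tAB, tA, tB, hreal, sub_self]
  -- (3) the route's conclusion at these data, tested on the zero-point term `F₀ = 1`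
  have hRP := h (Matrix.specialUnitaryGroup (Fin 2) ℂ) hG r (SpeciesScheme.zero _) S₁ hconv 1 one_pos
    hgap R a b ha hb hR
  haveI hE : IsEmpty (Fin (0 + 0)) := (inferInstance : IsEmpty (Fin 0))
  let c00 : SchwartzMap (Fin (0 + 0) → EuclideanSpace ℝ (Fin 4)) ℂ := SchwartzMap.constOfSubsingleton 1
  have hT : IsTimeOrdered (d := 4)
      (SchwartzMap.constOfSubsingleton 1 : SchwartzMap (Fin 0 → EuclideanSpace ℝ (Fin 4)) ℂ) := by
    intro x _
    exact ⟨fun i => i.elim0, fun i => i.elim0⟩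
  have key := hRP 1 (fun _ => 0) (fun _ _ => ()) (fun _ => SchwartzMap.constOfSubsingleton 1)
    (fun _ => hT) (fun _ _ => c00) (fun _ _ x => by simp [c00])
  obtain ⟨hre, -⟩ := key
  revert hre
  simp [S₁, c00]

end Summit.QuantumFields.YangMills.Theorems
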